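import Summits.KontsevichZagierPeriods.KontsevichZagierPeriods.Theses.FurushoPentagon
import Literature.NumberTheory.Transcendental.Associators

/-!
# `PentagonInKZ` — stub `stub_cornersCubical`: algebra of the cubical corner charts, I (aux)

Generator identities in `U𝔞₄ ⊗ S/(deg > N)` and, for the cubical corner charts C1 (vertex `(0,0)`
of the pentagon cell, divisors `ξ, η, 1-ξ, 1-η, 1-ξη`, residues `t₀₁, t₀₁+t₀₂+t₁₂, t₁₂, t₂₃, t₁₃`)
and C2 (vertex `(1,0)`, fifth divisor `1-η+ξη`, residues `t₁₂, t₀₁+t₀₂+t₁₂, t₀₁, t₂₃, t₁₃`):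
commutation of the edge residues, flatness and edge centralities with free letter densities,
integer residue tables, regularity of the divisors on the closed chart, closed forms and edge
values of the densities `f_k = ∂_ξ log φ_k`, `g_k = ∂_η log φ_k` (chart C5: file `…C5`).
-/

noncomputable section

open Literature.NumberTheory.Transcendental

namespace Summit.KontsevichZagierPeriods.FurushoPentagon.PentagonInKZ

namespace CornersCubical

open DrinfeldKohnoTrunc

variable {S : Type} [CommRing S] {N : ℕ}

/-- `[t₀₁,t₁₃] + [t₁₂,t₁₃] + [t₁₃, t₀₁+t₀₂+t₁₂] = [t₁₃,t₀₂] = 0`. [cite: Furusho2011, §2] -/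
theorem rel_A : (t S N 0 1 : DrinfeldKohnoTrunc S (Fin 4) N) * t S N 1 3 - t S N 1 3 * t S N 0 1 +
    (t S N 1 2 * t S N 1 3 - t S N 1 3 * t S N 1 2) +
    (t S N 1 3 * (t S N 0 1 + t S N 0 2 + t S N 1 2) -
      (t S N 0 1 + t S N 0 2 + t S N 1 2) * t S N 1 3) = 0 := by
  have h := t_comm (R := S) (N := N) (0 : Fin 4) 2 1 3 (by decide) (by decide) (by decide)
    (by decide) (by decide) (by decide)
  calc _ = -((t S N 0 2 : DrinfeldKohnoTrunc S (Fin 4) N) * t S N 1 3 - t S N 1 3 * t S N 0 2) := by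
        simp only [mul_add, add_mul]; abel
    _ = 0 := by rw [h, sub_self, neg_zero]

/-- `[t₀₁, t₀₁+t₀₂+t₁₂] = 0`. [cite: Furusho2011, §2] -/
theorem rel_B : (t S N 0 1 : DrinfeldKohnoTrunc S (Fin 4) N) * (t S N 0 1 + t S N 0 2 + t S N 1 2) -
    (t S N 0 1 + t S N 0 2 + t S N 1 2) * t S N 0 1 = 0 := by
  have h := t_mul_add (R := S) (N := N) (0 : Fin 4) 1 2 (by decide) (by decide) (by decide)
  calc _ = (t S N 0 1 : DrinfeldKohnoTrunc S (Fin 4) N) * (t S N 0 2 + t S N 1 2) -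
      (t S N 0 2 + t S N 1 2) * t S N 0 1 := by
        simp only [mul_add, add_mul]; abel
    _ = 0 := by rw [h, sub_self]

/-- `[t₀₁, t₂₃] = 0`. [cite: Furusho2011, §2] -/
theorem rel_C :
    (t S N 0 1 : DrinfeldKohnoTrunc S (Fin 4) N) * t S N 2 3 - t S N 2 3 * t S N 0 1 = 0 := by
  rw [t_comm (R := S) (N := N) (0 : Fin 4) 1 2 3 (by decide) (by decide) (by decide) (by decide)
    (by decide) (by decide), sub_self]

/-- `[t₁₂, t₀₁+t₀₂+t₁₂] = 0`. [cite: Furusho2011, §2] -/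
theorem rel_D : (t S N 1 2 : DrinfeldKohnoTrunc S (Fin 4) N) * (t S N 0 1 + t S N 0 2 + t S N 1 2) -
    (t S N 0 1 + t S N 0 2 + t S N 1 2) * t S N 1 2 = 0 := by
  have h := t_mul_add (R := S) (N := N) (1 : Fin 4) 2 0 (by decide) (by decide) (by decide)
  rw [t_symm (1 : Fin 4) 0, t_symm (2 : Fin 4) 0] at h
  calc _ = (t S N 1 2 : DrinfeldKohnoTrunc S (Fin 4) N) * (t S N 0 1 + t S N 0 2) -
      (t S N 0 1 + t S N 0 2) * t S N 1 2 := by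
        simp only [mul_add, add_mul]; abel
    _ = 0 := by rw [h, sub_self]

/-- `[t₁₂, t₂₃] + [t₁₂, t₁₃] = 0`. [cite: Furusho2011, §2] -/
theorem rel_E : (t S N 1 2 : DrinfeldKohnoTrunc S (Fin 4) N) * t S N 2 3 - t S N 2 3 * t S N 1 2 +
    (t S N 1 2 * t S N 1 3 - t S N 1 3 * t S N 1 2) = 0 := by
  have h := t_mul_add (R := S) (N := N) (1 : Fin 4) 2 3 (by decide) (by decide) (by decide)
  calc _ = (t S N 1 2 : DrinfeldKohnoTrunc S (Fin 4) N) * (t S N 1 3 + t S N 2 3) -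
      (t S N 1 3 + t S N 2 3) * t S N 1 2 := by
        simp only [mul_add, add_mul]; abel
    _ = 0 := by rw [h, sub_self]

/-- `[t₁₃, t₂₃] - [t₁₂, t₁₃] = 0`. [cite: Furusho2011, §2] -/
theorem rel_F : (t S N 1 3 : DrinfeldKohnoTrunc S (Fin 4) N) * t S N 2 3 - t S N 2 3 * t S N 1 3 -
    (t S N 1 2 * t S N 1 3 - t S N 1 3 * t S N 1 2) = 0 := by
  have h := t_mul_add (R := S) (N := N) (1 : Fin 4) 3 2 (by decide) (by decide) (by decide)
  rw [t_symm (3 : Fin 4) 2] at h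
  calc _ = (t S N 1 3 : DrinfeldKohnoTrunc S (Fin 4) N) * (t S N 1 2 + t S N 2 3) -
      (t S N 1 2 + t S N 2 3) * t S N 1 3 := by
        simp only [mul_add, add_mul]; abel
    _ = 0 := by rw [h, sub_self]

/-- `[t₁₂, t₂₃] + [t₁₃, t₂₃] = 0`. [cite: Furusho2011, §2] -/
theorem rel_G : (t S N 1 2 : DrinfeldKohnoTrunc S (Fin 4) N) * t S N 2 3 - t S N 2 3 * t S N 1 2 +
    (t S N 1 3 * t S N 2 3 - t S N 2 3 * t S N 1 3) = 0 := by
  have h := t_mul_add (R := S) (N := N) (2 : Fin 4) 3 1 (by decide) (by decide) (by decide)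
  rw [t_symm (2 : Fin 4) 1, t_symm (3 : Fin 4) 1] at h
  calc _ = -((t S N 2 3 : DrinfeldKohnoTrunc S (Fin 4) N) * (t S N 1 2 + t S N 1 3) -
      (t S N 1 2 + t S N 1 3) * t S N 2 3) := by
        simp only [mul_add, add_mul]; abel
    _ = 0 := by rw [h, sub_self, neg_zero]

/-- `c / (c u) = u⁻¹` for `c ≠ 0` (junk-compatible: both sides vanish at `u = 0`). [folklore] -/
theorem div_mul_left_eq_inv {c : ℝ} (hc : c ≠ 0) (u : ℝ) : c / (c * u) = u⁻¹ := by
  rw [div_mul_eq_div_div, div_self hc, one_div]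

/-- `-1/(1-u) = (u-1)⁻¹`. [folklore] -/
theorem neg_one_div_one_sub (u : ℝ) : -1 / (1 - u) = (u - 1)⁻¹ := by
  rw [show (1 : ℝ) - u = -1 * (u - 1) by ring]; exact div_mul_left_eq_inv (by norm_num) _

section C1Z -- chart C1: vertex `(0,0)`, `(ξ,η) = (u,v)`

variable (Z : Fin 5 → DrinfeldKohnoTrunc S (Fin 4) N)
  (hZ : Z = ![t S N 0 1, t S N 0 1 + t S N 0 2 + t S N 1 2, t S N 1 2, t S N 2 3, t S N 1 3])

include hZ in
/-- `Z₀ Z₁ = Z₁ Z₀` for chart C1. [cite: Drinfeld1991, §2] -/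
theorem comm01_C1 : Z 0 * Z 1 = Z 1 * Z 0 := by
  subst hZ
  simp only [Matrix.cons_val_zero, Matrix.cons_val_one]
  exact sub_eq_zero.mp rel_B

include hZ in
/-- Flatness sum of chart C1 with free letter densities. [cite: Drinfeld1991, §2] -/
theorem flat_C1 (F G : Fin 5 → S) (hF1 : F 1 = 0) (hF3 : F 3 = 0) (hG0 : G 0 = 0)
    (hG2 : G 2 = 0) (h1 : F 0 * G 4 = F 4 * G 1)
    (h2 : F 2 * G 4 = F 4 * G 1 + F 2 * G 3 - F 4 * G 3) :
    ∑ k : Fin 5, ∑ l : Fin 5, (F k * G l) • (Z k * Z l - Z l * Z k) = 0 := by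
  subst hZ; simp only [Fin.sum_univ_five]
  simp only [Matrix.cons_val_zero, Matrix.cons_val_one, Matrix.head_cons, Matrix.cons_val_two,
    Matrix.tail_cons, Matrix.cons_val_three, Matrix.cons_val_four, hF1, hF3, hG0, hG2, zero_mul,
    mul_zero, zero_smul, add_zero, zero_add, sub_self, smul_zero, h1, h2]
  linear_combination (norm := skip) (F 4 * G 1) • (rel_A (S := S) (N := N))
    + (F 0 * G 1) • (rel_B (S := S) (N := N))
    + (F 0 * G 3) • (rel_C (S := S) (N := N))
    + (F 2 * G 1) • (rel_D (S := S) (N := N))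
    + (F 2 * G 3) • (rel_E (S := S) (N := N))
    + (F 4 * G 3) • (rel_F (S := S) (N := N))
  simp only [smul_add, smul_sub, add_smul, sub_smul, smul_zero, mul_add, add_mul]
  abel

include hZ in
/-- Centrality of `Z₀` on the edge `ξ = 0` for chart C1 (free densities).
[cite: Drinfeld1991, §2] -/
theorem central0_C1 (G : Fin 5 → S) (hG0 : G 0 = 0) (hG2 : G 2 = 0) (hG4 : G 4 = 0) :
    ∑ l : Fin 5, G l • (Z 0 * Z l - Z l * Z 0) = 0 := by
  subst hZ; simp only [Fin.sum_univ_five]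
  simp only [Matrix.cons_val_zero, Matrix.cons_val_one, Matrix.head_cons, Matrix.cons_val_two,
    Matrix.tail_cons, Matrix.cons_val_three, Matrix.cons_val_four, hG0, hG2, hG4, zero_smul,
    add_zero, sub_self, smul_zero]
  simp only [rel_B, rel_C, smul_zero, add_zero]

include hZ in
/-- Centrality of `Z₁` on the edge `η = 0` for chart C1 (free densities).
[cite: Drinfeld1991, §2] -/
theorem central1_C1 (F : Fin 5 → S) (hF1 : F 1 = 0) (hF3 : F 3 = 0) (hF4 : F 4 = 0) :
    ∑ k : Fin 5, F k • (Z 1 * Z k - Z k * Z 1) = 0 := by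
  subst hZ; simp only [Fin.sum_univ_five]
  simp only [Matrix.cons_val_zero, Matrix.cons_val_one, Matrix.head_cons, Matrix.cons_val_two,
    Matrix.tail_cons, Matrix.cons_val_three, Matrix.cons_val_four, hF1, hF3, hF4, zero_smul,
    add_zero, sub_self, smul_zero]
  have hB' := neg_eq_zero.mpr (rel_B (S := S) (N := N))
  have hD' := neg_eq_zero.mpr (rel_D (S := S) (N := N))
  rw [neg_sub] at hB' hD'
  simp only [hB', hD', smul_zero, add_zero]

include hZ in
/-- The residues of chart C1 as integer combinations of the `t_ij`. [cite: Drinfeld1991, §2] -/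
theorem sum_nZ_C1 (k : Fin 5) :
    ∑ i : Fin 4, ∑ j : Fin 4, (((![![![0, 1, 0, 0], ![0, 0, 0, 0], ![0, 0, 0, 0], ![0, 0, 0, 0]],
      ![![0, 1, 1, 0], ![0, 0, 1, 0], ![0, 0, 0, 0], ![0, 0, 0, 0]],
      ![![0, 0, 0, 0], ![0, 0, 1, 0], ![0, 0, 0, 0], ![0, 0, 0, 0]],
      ![![0, 0, 0, 0], ![0, 0, 0, 0], ![0, 0, 0, 1], ![0, 0, 0, 0]],
      ![![0, 0, 0, 0], ![0, 0, 0, 1], ![0, 0, 0, 0], ![0, 0, 0, 0]]] :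
        Fin 5 → Fin 4 → Fin 4 → ℤ) k i j : ℤ) : S) • t S N i j = Z k := by
  subst hZ
  fin_cases k <;> simp [Fin.sum_univ_four]

end C1Z

section C1cf

variable (cf : Fin 5 → Fin 4 → ℚ)
  (hcf : cf = ![![0, 1, 0, 0], ![0, 0, 1, 0], ![1, -1, 0, 0], ![1, 0, -1, 0], ![1, 0, 0, -1]])

include hcf in
/-- The divisors of chart C1 other than the two edges do not vanish on the closed chart
`[0, 1/2]²`. [folklore] -/
theorem hreg_C1 (φ : Fin 5 → ℝ → ℝ → ℝ)
    (hφ : ∀ k x y, φ k x y = cf k 0 + cf k 1 * x + cf k 2 * y + cf k 3 * x * y) :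
    ∀ k : Fin 5, k ≠ 0 → k ≠ 1 → ∀ x y : ℝ, 0 ≤ x → x ≤ ((1 / 2 : ℚ) : ℝ) → 0 ≤ y →
      y ≤ ((1 / 2 : ℚ) : ℝ) → φ k x y ≠ 0 := by
  subst hcf
  intro k hk0 hk1 x y hx0 hx1 hy0 hy1
  have h2 : ((1 / 2 : ℚ) : ℝ) = 1 / 2 := by norm_num
  rw [h2] at hx1 hy1
  fin_cases k
  · exact absurd rfl hk0
  · exact absurd rfl hk1
  · rw [hφ]; simp; nlinarith
  · rw [hφ]; simp; nlinarith
  · rw [hφ]; simp; nlinarith [mul_le_mul hx1 hy1 hy0 (by norm_num : (0:ℝ) ≤ 1 / 2)]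

include hcf in
/-- Closed forms of the letter densities `f_k = ∂_ξ log φ_k`, `g_k = ∂_η log φ_k` of chart C1.
[folklore] -/
theorem fg_C1 (φ f g : Fin 5 → ℝ → ℝ → ℝ)
    (hφ : ∀ k x y, φ k x y = cf k 0 + cf k 1 * x + cf k 2 * y + cf k 3 * x * y)
    (hf : ∀ k x y, f k x y = (cf k 1 + cf k 3 * y) / φ k x y)
    (hg : ∀ k x y, g k x y = (cf k 2 + cf k 3 * x) / φ k x y) (x y : ℝ) :
    (f 0 x y = 1 / x ∧ f 1 x y = 0 ∧ f 2 x y = -1 / (1 - x) ∧ f 3 x y = 0 ∧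
      f 4 x y = -y / (1 - x * y)) ∧
    (g 0 x y = 0 ∧ g 1 x y = 1 / y ∧ g 2 x y = 0 ∧ g 3 x y = -1 / (1 - y) ∧
      g 4 x y = -x / (1 - x * y)) := by
  subst hcf
  refine ⟨⟨?_, ?_, ?_, ?_, ?_⟩, ?_, ?_, ?_, ?_, ?_⟩ <;>
  simp only [hf, hg, hφ, Matrix.cons_val_zero, Matrix.cons_val_one, Matrix.head_cons,
    Matrix.cons_val_two, Matrix.tail_cons, Matrix.cons_val_three, Matrix.cons_val_four] <;>
  push_cast <;> ring

end C1cf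

/-- Edge values of the letter densities of chart C1 on the four sides `η = 0`, `η = 1/2`,
`ξ = 0`, `ξ = 1/2` (a density is `0` or `1/(t - pole)`, pole `∈ {0, 1, 2, -1}`). [folklore] -/
theorem edge_C1 (f g : Fin 5 → ℝ → ℝ → ℝ)
    (hfg : ∀ x y : ℝ, (f 0 x y = 1 / x ∧ f 1 x y = 0 ∧ f 2 x y = -1 / (1 - x) ∧ f 3 x y = 0 ∧
      f 4 x y = -y / (1 - x * y)) ∧
    (g 0 x y = 0 ∧ g 1 x y = 1 / y ∧ g 2 x y = 0 ∧ g 3 x y = -1 / (1 - y) ∧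
      g 4 x y = -x / (1 - x * y))) (t : ℝ) :
    (f 0 t 0 = t⁻¹ ∧ f 1 t 0 = 0 ∧ f 2 t 0 = (t - 1)⁻¹ ∧ f 3 t 0 = 0 ∧ f 4 t 0 = 0) ∧
    (f 0 t 2⁻¹ = t⁻¹ ∧ f 1 t 2⁻¹ = 0 ∧ f 2 t 2⁻¹ = (t - 1)⁻¹ ∧ f 3 t 2⁻¹ = 0 ∧
      f 4 t 2⁻¹ = (t - 2)⁻¹) ∧
    (g 0 0 t = 0 ∧ g 1 0 t = t⁻¹ ∧ g 2 0 t = 0 ∧ g 3 0 t = (t - 1)⁻¹ ∧ g 4 0 t = 0) ∧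
    (g 0 2⁻¹ t = 0 ∧ g 1 2⁻¹ t = t⁻¹ ∧ g 2 2⁻¹ t = 0 ∧ g 3 2⁻¹ t = (t - 1)⁻¹ ∧
      g 4 2⁻¹ t = (t - 2)⁻¹) := by
  obtain ⟨⟨a0, a1, a2, a3, a4⟩, -⟩ := hfg t 0
  obtain ⟨⟨b0, b1, b2, b3, b4⟩, -⟩ := hfg t 2⁻¹
  obtain ⟨-, c0, c1, c2, c3, c4⟩ := hfg 0 t
  obtain ⟨-, d0, d1, d2, d3, d4⟩ := hfg 2⁻¹ t
  refine ⟨⟨by rw [a0, one_div], a1, by rw [a2, neg_one_div_one_sub], a3, ?_⟩,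
    ⟨by rw [b0, one_div], b1, by rw [b2, neg_one_div_one_sub], b3, ?_⟩,
    ⟨c0, by rw [c1, one_div], c2, by rw [c3, neg_one_div_one_sub], ?_⟩,
    ⟨d0, by rw [d1, one_div], d2, by rw [d3, neg_one_div_one_sub], ?_⟩⟩
  · rw [a4]; simp
  · rw [b4, show (1 : ℝ) - t * 2⁻¹ = -2⁻¹ * (t - 2) by ring]
    exact div_mul_left_eq_inv (by norm_num) _
  · rw [c4]; simp
  · rw [d4, show (1 : ℝ) - 2⁻¹ * t = -2⁻¹ * (t - 2) by ring]
    exact div_mul_left_eq_inv (by norm_num) _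

section C2Z -- chart C2: vertex `(1,0)`, `(ξ,η) = (1-u,v)`

variable (Z : Fin 5 → DrinfeldKohnoTrunc S (Fin 4) N)
  (hZ : Z = ![t S N 1 2, t S N 0 1 + t S N 0 2 + t S N 1 2, t S N 0 1, t S N 2 3, t S N 1 3])

include hZ in
/-- `Z₀ Z₁ = Z₁ Z₀` for chart C2. [cite: Drinfeld1991, §2] -/
theorem comm01_C2 : Z 0 * Z 1 = Z 1 * Z 0 := by
  subst hZ
  simp only [Matrix.cons_val_zero, Matrix.cons_val_one]
  exact sub_eq_zero.mp rel_D

include hZ in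
/-- Flatness sum of chart C2 with free letter densities. [cite: Drinfeld1991, §2] -/
theorem flat_C2 (F G : Fin 5 → S) (hF1 : F 1 = 0) (hF3 : F 3 = 0) (hG0 : G 0 = 0)
    (hG2 : G 2 = 0) (h1 : F 2 * G 4 = F 4 * G 1)
    (h2 : F 0 * G 4 = F 0 * G 3 + F 4 * G 1 - F 4 * G 3) :
    ∑ k : Fin 5, ∑ l : Fin 5, (F k * G l) • (Z k * Z l - Z l * Z k) = 0 := by
  subst hZ; simp only [Fin.sum_univ_five]
  simp only [Matrix.cons_val_zero, Matrix.cons_val_one, Matrix.head_cons, Matrix.cons_val_two,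
    Matrix.tail_cons, Matrix.cons_val_three, Matrix.cons_val_four, hF1, hF3, hG0, hG2, zero_mul,
    mul_zero, zero_smul, add_zero, zero_add, sub_self, smul_zero, h1, h2]
  linear_combination (norm := skip) (F 0 * G 1) • (rel_D (S := S) (N := N))
    + (F 0 * G 3) • (rel_E (S := S) (N := N))
    + (F 4 * G 1) • (rel_A (S := S) (N := N))
    + (F 4 * G 3) • (rel_F (S := S) (N := N))
    + (F 2 * G 1) • (rel_B (S := S) (N := N))
    + (F 2 * G 3) • (rel_C (S := S) (N := N))
  simp only [smul_add, smul_sub, add_smul, sub_smul, smul_zero, mul_add, add_mul]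
  abel

include hZ in
/-- Centrality of `Z₀` on the edge `ξ = 0` for chart C2 (free densities).
[cite: Drinfeld1991, §2] -/
theorem central0_C2 (G : Fin 5 → S) (hG0 : G 0 = 0) (hG2 : G 2 = 0) (hG4 : G 4 = G 3) :
    ∑ l : Fin 5, G l • (Z 0 * Z l - Z l * Z 0) = 0 := by
  subst hZ; simp only [Fin.sum_univ_five]
  simp only [Matrix.cons_val_zero, Matrix.cons_val_one, Matrix.head_cons, Matrix.cons_val_two,
    Matrix.tail_cons, Matrix.cons_val_three, Matrix.cons_val_four, hG0, hG2, hG4, zero_smul,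
    add_zero, sub_self, smul_zero]
  simp only [rel_D, smul_zero, zero_add, ← smul_add, rel_E]

include hZ in
/-- Centrality of `Z₁` on the edge `η = 0` for chart C2 (free densities).
[cite: Drinfeld1991, §2] -/
theorem central1_C2 (F : Fin 5 → S) (hF1 : F 1 = 0) (hF3 : F 3 = 0) (hF4 : F 4 = 0) :
    ∑ k : Fin 5, F k • (Z 1 * Z k - Z k * Z 1) = 0 := by
  subst hZ; simp only [Fin.sum_univ_five]
  simp only [Matrix.cons_val_zero, Matrix.cons_val_one, Matrix.head_cons, Matrix.cons_val_two,
    Matrix.tail_cons, Matrix.cons_val_three, Matrix.cons_val_four, hF1, hF3, hF4, zero_smul,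
    add_zero, sub_self, smul_zero]
  have hB' := neg_eq_zero.mpr (rel_B (S := S) (N := N))
  have hD' := neg_eq_zero.mpr (rel_D (S := S) (N := N))
  rw [neg_sub] at hB' hD'
  simp only [hB', hD', smul_zero, add_zero]

include hZ in
/-- The residues of chart C2 as integer combinations of the `t_ij`. [cite: Drinfeld1991, §2] -/
theorem sum_nZ_C2 (k : Fin 5) :
    ∑ i : Fin 4, ∑ j : Fin 4, (((![![![0, 0, 0, 0], ![0, 0, 1, 0], ![0, 0, 0, 0], ![0, 0, 0, 0]],
      ![![0, 1, 1, 0], ![0, 0, 1, 0], ![0, 0, 0, 0], ![0, 0, 0, 0]],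
      ![![0, 1, 0, 0], ![0, 0, 0, 0], ![0, 0, 0, 0], ![0, 0, 0, 0]],
      ![![0, 0, 0, 0], ![0, 0, 0, 0], ![0, 0, 0, 1], ![0, 0, 0, 0]],
      ![![0, 0, 0, 0], ![0, 0, 0, 1], ![0, 0, 0, 0], ![0, 0, 0, 0]]] :
        Fin 5 → Fin 4 → Fin 4 → ℤ) k i j : ℤ) : S) • t S N i j = Z k := by
  subst hZ
  fin_cases k <;> simp [Fin.sum_univ_four]

end C2Z

section C2cf

variable (cf : Fin 5 → Fin 4 → ℚ)
  (hcf : cf = ![![0, 1, 0, 0], ![0, 0, 1, 0], ![1, -1, 0, 0], ![1, 0, -1, 0], ![1, 0, -1, 1]])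

include hcf in
/-- The divisors of chart C2 other than the two edges do not vanish on the closed chart
`[0, 1/2]²`. [folklore] -/
theorem hreg_C2 (φ : Fin 5 → ℝ → ℝ → ℝ)
    (hφ : ∀ k x y, φ k x y = cf k 0 + cf k 1 * x + cf k 2 * y + cf k 3 * x * y) :
    ∀ k : Fin 5, k ≠ 0 → k ≠ 1 → ∀ x y : ℝ, 0 ≤ x → x ≤ ((1 / 2 : ℚ) : ℝ) → 0 ≤ y →
      y ≤ ((1 / 2 : ℚ) : ℝ) → φ k x y ≠ 0 := by
  subst hcf
  intro k hk0 hk1 x y hx0 hx1 hy0 hy1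
  have h2 : ((1 / 2 : ℚ) : ℝ) = 1 / 2 := by norm_num
  rw [h2] at hx1 hy1
  fin_cases k
  · exact absurd rfl hk0
  · exact absurd rfl hk1
  · rw [hφ]; simp; nlinarith
  · rw [hφ]; simp; nlinarith
  · rw [hφ]; simp; nlinarith [mul_nonneg hx0 hy0]

include hcf in
/-- Closed forms of the letter densities `f_k = ∂_ξ log φ_k`, `g_k = ∂_η log φ_k` of chart C2.
[folklore] -/
theorem fg_C2 (φ f g : Fin 5 → ℝ → ℝ → ℝ)
    (hφ : ∀ k x y, φ k x y = cf k 0 + cf k 1 * x + cf k 2 * y + cf k 3 * x * y)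
    (hf : ∀ k x y, f k x y = (cf k 1 + cf k 3 * y) / φ k x y)
    (hg : ∀ k x y, g k x y = (cf k 2 + cf k 3 * x) / φ k x y) (x y : ℝ) :
    (f 0 x y = 1 / x ∧ f 1 x y = 0 ∧ f 2 x y = -1 / (1 - x) ∧ f 3 x y = 0 ∧
      f 4 x y = y / (1 - y + x * y)) ∧
    (g 0 x y = 0 ∧ g 1 x y = 1 / y ∧ g 2 x y = 0 ∧ g 3 x y = -1 / (1 - y) ∧
      g 4 x y = (-1 + x) / (1 - y + x * y)) := by
  subst hcf
  refine ⟨⟨?_, ?_, ?_, ?_, ?_⟩, ?_, ?_, ?_, ?_, ?_⟩ <;>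
  simp only [hf, hg, hφ, Matrix.cons_val_zero, Matrix.cons_val_one, Matrix.head_cons,
    Matrix.cons_val_two, Matrix.tail_cons, Matrix.cons_val_three, Matrix.cons_val_four] <;>
  push_cast <;> ring

end C2cf

/-- Edge values of the letter densities of chart C2 on the four sides `η = 0`, `η = 1/2`,
`ξ = 0`, `ξ = 1/2` (a density is `0` or `1/(t - pole)`, pole `∈ {0, 1, 2, -1}`). [folklore] -/
theorem edge_C2 (f g : Fin 5 → ℝ → ℝ → ℝ)
    (hfg : ∀ x y : ℝ, (f 0 x y = 1 / x ∧ f 1 x y = 0 ∧ f 2 x y = -1 / (1 - x) ∧ f 3 x y = 0 ∧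
      f 4 x y = y / (1 - y + x * y)) ∧
    (g 0 x y = 0 ∧ g 1 x y = 1 / y ∧ g 2 x y = 0 ∧ g 3 x y = -1 / (1 - y) ∧
      g 4 x y = (-1 + x) / (1 - y + x * y))) (t : ℝ) :
    (f 0 t 0 = t⁻¹ ∧ f 1 t 0 = 0 ∧ f 2 t 0 = (t - 1)⁻¹ ∧ f 3 t 0 = 0 ∧ f 4 t 0 = 0) ∧
    (f 0 t 2⁻¹ = t⁻¹ ∧ f 1 t 2⁻¹ = 0 ∧ f 2 t 2⁻¹ = (t - 1)⁻¹ ∧ f 3 t 2⁻¹ = 0 ∧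
      f 4 t 2⁻¹ = (t + 1)⁻¹) ∧
    (g 0 0 t = 0 ∧ g 1 0 t = t⁻¹ ∧ g 2 0 t = 0 ∧ g 3 0 t = (t - 1)⁻¹ ∧ g 4 0 t = (t - 1)⁻¹) ∧
    (g 0 2⁻¹ t = 0 ∧ g 1 2⁻¹ t = t⁻¹ ∧ g 2 2⁻¹ t = 0 ∧ g 3 2⁻¹ t = (t - 1)⁻¹ ∧
      g 4 2⁻¹ t = (t - 2)⁻¹) := by
  obtain ⟨⟨a0, a1, a2, a3, a4⟩, -⟩ := hfg t 0
  obtain ⟨⟨b0, b1, b2, b3, b4⟩, -⟩ := hfg t 2⁻¹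
  obtain ⟨-, c0, c1, c2, c3, c4⟩ := hfg 0 t
  obtain ⟨-, d0, d1, d2, d3, d4⟩ := hfg 2⁻¹ t
  refine ⟨⟨by rw [a0, one_div], a1, by rw [a2, neg_one_div_one_sub], a3, ?_⟩,
    ⟨by rw [b0, one_div], b1, by rw [b2, neg_one_div_one_sub], b3, ?_⟩,
    ⟨c0, by rw [c1, one_div], c2, by rw [c3, neg_one_div_one_sub], ?_⟩,
    ⟨d0, by rw [d1, one_div], d2, by rw [d3, neg_one_div_one_sub], ?_⟩⟩
  · rw [a4]; simp
  · rw [b4, show (1 : ℝ) - 2⁻¹ + t * 2⁻¹ = 2⁻¹ * (t + 1) by ring]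
    exact div_mul_left_eq_inv (by norm_num) _
  · rw [c4, show (-1 : ℝ) + 0 = -1 by norm_num, show (1 : ℝ) - t + 0 * t = -1 * (t - 1) by ring]
    exact div_mul_left_eq_inv (by norm_num) _
  · rw [d4, show (-1 : ℝ) + 2⁻¹ = -2⁻¹ by norm_num,
      show (1 : ℝ) - t + 2⁻¹ * t = -2⁻¹ * (t - 2) by ring]
    exact div_mul_left_eq_inv (by norm_num) _

end CornersCubical

/-- **Sub-stub `cornersCubical_flatC1` of `stub_cornersCubical`**: flatness
`Σ_{k,l} f_k g_l [Z_k, Z_l] = 0` of the KZ-type connection of the corner chart C1 (vertex `(0,0)`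
of the pentagon cell; residues `t₀₁, t₀₁+t₀₂+t₁₂, t₁₂, t₂₃, t₁₃`) in `U𝔞₄ ⊗ S/(deg > N)`, for free
letter densities subject to the two scalar identities of the chart. [cite: Drinfeld1991, §2] -/
theorem cornersCubical_flatC1 :
    ∀ (S : Type) [CommRing S] (N : ℕ) (Z : Fin 5 → DrinfeldKohnoTrunc S (Fin 4) N), Z = ![DrinfeldKohnoTrunc.t S N 0 1, DrinfeldKohnoTrunc.t S N 0 1 + DrinfeldKohnoTrunc.t S N 0 2 + DrinfeldKohnoTrunc.t S N 1 2, DrinfeldKohnoTrunc.t S N 1 2, DrinfeldKohnoTrunc.t S N 2 3, DrinfeldKohnoTrunc.t S N 1 3] → ∀ (F G : Fin 5 → S), F 1 = 0 → F 3 = 0 → G 0 = 0 → G 2 = 0 → F 0 * G 4 = F 4 * G 1 → F 2 * G 4 = F 4 * G 1 + F 2 * G 3 - F 4 * G 3 → ∑ k : Fin 5, ∑ l : Fin 5, (F k * G l) • (Z k * Z l - Z l * Z k) = 0 := by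
  intro S _ N Z hZ F G hF1 hF3 hG0 hG2 h1 h2
  exact CornersCubical.flat_C1 Z hZ F G hF1 hF3 hG0 hG2 h1 h2

end Summit.KontsevichZagierPeriods.FurushoPentagon.PentagonInKZ
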